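import Mathlib
import Literature.NumberTheory.Automorphic.ReciprocityGLn
import Literature.NumberTheory.Automorphic.AutomorphicRepsGL
import Literature.NumberTheory.Automorphic.GLnAdelicStructure
import Literature.NumberTheory.GaloisRepresentations.ModPGaloisRep
import Literature.NumberTheory.GaloisRepresentations.GaloisRep
import Literature.NumberTheory.GaloisRepresentations.SymplecticMultiplier
import Literature.NumberTheory.GaloisRepresentations.LocalGaloisGroup
import Literature.NumberTheory.DiophantineGeometry.WeilPairingRationalTateModule
import Literature.NumberTheory.GaloisRepresentations.SerreWeight
import Literature.NumberTheory.GaloisRepresentations.ResidualPair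
import Literature.NumberTheory.GaloisRepresentations.ResidualPairIntegrality
import Literature.NumberTheory.GaloisRepresentations.FramedRepBaseChange
import Literature.NumberTheory.GaloisRepresentations.ArtinRestriction
import Literature.NumberTheory.Automorphic.AdicCompletionLocalField
import Literature.NumberTheory.Automorphic.GLnAdelicStructureProofs
import Literature.NumberTheory.DiophantineGeometry.AVGaloisModule
import Literature.NumberTheory.DiophantineGeometry.AVGaloisModuleContinuityProofs
import Literature.NumberTheory.DiophantineGeometry.AVGaloisModuleTateRankOfCubeProofs
import Literature.NumberTheory.DiophantineGeometry.AbelianVarietyOrdinaryReduction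
import Literature.FieldTheory.AlgClosed.PadicAlgClEquivComplex
import HarnessLib

/-!
# BcgpSwitchExistsModularAbelianSurface

Topic `Literature/NumberTheory/DiophantineGeometry`. Named literature fact(s) relocated by the gate from `Summits/Langlands/Langlands/Theorems/PhantomRMYoshidaStableYoshidaCongruenceSwitchToModularSurface.lean`
(accept-time relocation of `[cite]`d propositions written inline in a Summits proposal; human ruling 2026-08-15).
Sources: BoxerCalegariGeePilloni2025, Serre1987.

* `Literature.NumberTheory.DiophantineGeometry.bcgp_switch_exists_modular_abelianSurface`
-/

namespace Literature.NumberTheory.DiophantineGeometry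

open CategoryTheory IsDedekindDomain
open scoped NumberField Matrix
open Literature.NumberTheory.GaloisRepresentations Literature.NumberTheory.Automorphic
open Literature.AlgebraicGeometry.Motives (AbelianVariety)
open Literature.NumberTheory.DiophantineGeometry (weilPairing_rationalTateModule)

/-- **Boxer–Calegari–Gee–Pilloni, the `2`–`3` switch lands on a modular abelian surface**
(arXiv:2502.20645: Lemma 9.4.2 (2) with its "Moreover", the 2-adic ordinary modularity
Theorem 8.3.2 ("residually `A₅(b)`") and the transfer `GSp₄ → GL₄`, combined VERBATIM as in
the first half of the proof of Thm. 9.5.2).  INPUT, as printed in Lemma 9.4.2: `ρ̄ : G_ℚ → GSp₄(𝔽₃)` with similitude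
`ε̄⁻¹` (first hypothesis: tree `IsSymplecticWithMultiplierFun` with multiplier the inverse of the
tree's mod-`3` cyclotomic character `modPCyclotomicCharacterZMod ℚ 3`); "`ρ̄^∨|_{G_{ℚ₃}}` is ordinary
and finite flat" — by ibid. Cor. 9.3.6 "ordinary" means `ρ̄^∨` is an extension of an unramified
2-dimensional `V̄` by its Cartier dual, i.e. `ρ̄|_{Γ_{ℚ₃}}` is block upper-triangular in some frame
with inertia trivial on the rank-2 sub and the scalar `ε̄⁻¹` on the rank-2 quotient (second
hypothesis, clauses on `absInertia`), and for this shape "finite flat over `ℤ₃`" is the PEU RAMIFIÉ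
condition (second hypothesis, `ModPGaloisRep.IsPeuRamifie`: all upper ramification groups `I^u`,
`u > 1`, act trivially — the extension classes are Kummer classes in `H¹(ℚ₃^{nr}, μ₃ ⊗ unr)`, the
flat ones are the unit classes, of upper jump `≤ 1`, the others have jump `3/2`; Serre 1987 §2.4,
§2.8; the same translation is recorded in the docstring of the tree's `IsPeuRamifie`);
"`ρ̄|_{G_{ℚ₂}}` is unramified" and condition (1)(a) "the image of `ρ̄(Frob₂)` in
`PGSp₄(𝔽₃) ∖ PSp₄(𝔽₃)` is not conjugate to `4C` or `12C`", equivalently (Thm. 9.5.2 (2) and the table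
of Lemma 9.1.3) `charpoly ρ̄(Frob₂) ≠ (x² ± x + 2)²` (third hypothesis).  NO irreducibility or
big-image hypothesis on `ρ̄` (the twisted moduli space `P(ρ̄)` is smooth and rational over `ℚ` for
every such `ρ̄`, Def. 9.2.1).  OUTPUT: a genus-2 Jacobian `B/ℚ` — recorded as an abelian variety of
dimension `2` (tree `AbelianVariety ℚ`, `AbelianVariety.dim`) — with (2)(c) good ordinary reduction at
`3` (tree `HasGoodOrdinaryReductionAt`); "Moreover `End(B_ℚ̄) = ℤ`", recorded through its consequence
`End_ℚ(B) = ℤ · id`; (2)(a) `ρ̄_{B,3} ≅ ρ̄`, recorded through its consequence on characteristic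
polynomials: for the framed representation `r` of `Γ_ℚ` on `H¹_ét(B_ℚ̄, ℚ̄₃) = (V₃ B)^∨ ⊗ ℚ̄₃` (the
paper's `ρ_{B,3}`, §1.8.23: multiplier `ε⁻¹`, `ρ_{B,3}^∨ ≅ ρ_{B,3} ⊗ ε = T₃ B`) written in the dual
basis of any `ℚ₃`-basis `b` of `V₃ B` (tree `rationalTateModule`, `rationalTateRep`; frame clause
`r(g) = [g⁻¹]_bᵀ`), every `det(X - r(g))`, `g ∈ Γ_ℚ`, lies in `ℤ₃[X]` (it is the characteristic
polynomial of `g` on the lattice `T₃(B)^∨`) and reduces mod `3` to `det(X - ρ̄(g))`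
(`T₃(B)^∨ / 3 = B[3]^∨ = ρ̄_{B,3} ≅ ρ̄`); and `B` is MODULAR (Thm. 8.3.2 applied to `B`, whose
hypotheses (2)(b), (2)(d) of Lemma 9.4.2 supply; `ρ_{B,3}` is irreducible as `End(B_ℚ̄) = ℤ`, so the
weight-2 `π` on `GSp₄/ℚ` is of general type and transfers to a cuspidal automorphic representation of
`GL₄(𝔸_ℚ)` with `L(s, H¹(B)) = L(s, π)`, §1.8.22, Def. 1.8.25 and the statement of Thm. 9.5.2):
recorded in the summit's almost-everywhere L-normalised form — for every `ι : ℚ̄₃ ≃ ℂ` there is an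
L-algebraic cuspidal `π` of `GL₄(𝔸_ℚ)` (tree `CuspidalAutomorphicRepData`, `IsLAlgebraic`) whose
Satake parameters `a_v` (tree `HasSatakeParamAt`) satisfy, at almost all `v`, `r` unramified at `v`
and `det(X - r(Frob_v)) = ∏ (X - ι⁻¹(a_{v,j}⁻¹))` (tree `arithFrobPolyOfSatake ι q_v 1`, arithmetic
Frobenius; i.e. the `a_{v,j}` are the Frobenius eigenvalues of `B` at `v`, `L(s, π_v) = L_v(s, H¹(B))`).
[cite: BoxerCalegariGeePilloni2025, Lemma 9.4.2, Cor. 9.3.6, Remarks 9.4.3–9.4.4, Thm. 8.3.2 (residually A₅(b)), Thm. 9.5.2 and its proof, Def. 9.2.1, Lemma 9.1.3, §1.8.9 with Def. 1.8.10, §1.8.22–1.8.24 with Def. 1.8.25 (arXiv:2502.20645v1 numbering, checked against the arXiv HTML render)]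
[cite: Serre1987, §2.4, §2.8 (peu ramifié = finite flat Kummer classes)]
[topic NumberTheory/DiophantineGeometry] -/
def bcgp_switch_exists_modular_abelianSurface : Prop :=
  ∀ (ρb : FramedGaloisRep ℚ (ZMod 3) 4),
    ρb.IsSymplecticWithMultiplierFun
        (fun g => (((modPCyclotomicCharacterZMod ℚ 3 g)⁻¹ : (ZMod 3)ˣ) : ZMod 3)) →
    (∀ v : HeightOneSpectrum (𝓞 ℚ), ((3 : ℕ) : 𝓞 ℚ) ∈ v.asIdeal →
      ModPGaloisRep.IsPeuRamifie (ρb.toLocal v) ∧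
      ∃ g : GL (Fin 4) (ZMod 3),
        (∀ (τ : Field.absoluteGaloisGroup (v.adicCompletion ℚ)) (i j : Fin 4),
            2 ≤ (i : ℕ) → (j : ℕ) < 2 → (g * ρb.toLocal v τ * g⁻¹).val i j = 0) ∧
        (∀ τ ∈ absInertia (v.adicCompletion ℚ), ∀ i j : Fin 4, (i : ℕ) < 2 → (j : ℕ) < 2 →
            (g * ρb.toLocal v τ * g⁻¹).val i j = if i = j then 1 else 0) ∧
        (∀ τ ∈ absInertia (v.adicCompletion ℚ), ∀ i j : Fin 4, 2 ≤ (i : ℕ) → 2 ≤ (j : ℕ) →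
            (g * ρb.toLocal v τ * g⁻¹).val i j =
              if i = j then
                (((modPCyclotomicCharacterZMod ℚ 3 (absGaloisRestrict ℚ (v.adicCompletion ℚ) τ))⁻¹ :
                    (ZMod 3)ˣ) : ZMod 3)
              else 0)) →
    (∀ v : HeightOneSpectrum (𝓞 ℚ), ((2 : ℕ) : 𝓞 ℚ) ∈ v.asIdeal →
      ρb.IsUnramifiedAt v ∧
        ∀ Q : Polynomial (ZMod 3), ρb.HasFrobCharpolyAt v Q →
          Q ≠ (Polynomial.X ^ 2 + Polynomial.X + 2) ^ 2 ∧
            Q ≠ (Polynomial.X ^ 2 - Polynomial.X + 2) ^ 2) →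
    ∃ B : AbelianVariety ℚ,
      B.dim = 2 ∧
      (∀ v : HeightOneSpectrum (𝓞 ℚ), ((3 : ℕ) : 𝓞 ℚ) ∈ v.asIdeal →
        B.HasGoodOrdinaryReductionAt v) ∧
      (∀ f : B ⟶ B, ∃ n : ℤ, f = n • 𝟙 B) ∧
      ∀ (b : Module.Basis (Fin 4) ℚ_[3] (B.rationalTateModule 3))
        (r : FramedGaloisRep ℚ (PadicAlgCl 3) 4),
        (∀ g : Field.absoluteGaloisGroup ℚ,
          (r g).val =
            ((LinearMap.toMatrix b b (B.rationalTateRep 3 g⁻¹)).map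
              (algebraMap ℚ_[3] (PadicAlgCl 3))).transpose) →
        (∀ g : Field.absoluteGaloisGroup ℚ, ∃ P : Polynomial ℤ_[3],
            P.map (algebraMap ℤ_[3] (PadicAlgCl 3)) = FramedRep.charpoly r g ∧
            P.map (PadicInt.toZMod (p := 3)) = FramedRep.charpoly ρb g) ∧
        ∀ (hcpt : isCompact_glFiniteIntegralLevel 4 ℚ) (ι : PadicAlgCl 3 ≃+* ℂ),
          ∃ π : CuspidalAutomorphicRepData 4 ℚ hcpt, π.1.IsLAlgebraic ∧
            ∀ᶠ v : HeightOneSpectrum (𝓞 ℚ) in Filter.cofinite, ∃ a : Multiset ℂ,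
              π.1.HasSatakeParamAt v a ∧ r.IsUnramifiedAt v ∧
                r.HasFrobCharpolyAt v (arithFrobPolyOfSatake ι v.residueCard 1 a)

end Literature.NumberTheory.DiophantineGeometry
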